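import Summits.NavierStokesRegularity.NavierStokesRegularity.Theses.AxisymmetricExtremality
import Literature.Barriers.NavierStokesRegularity.ContinuityMethodClosedness
import Literature.Analysis.FluidPDE.KatoViscosityScaling
import Literature.Analysis.FluidPDE.AxisymmetricEuler
import Literature.Analysis.FluidPDE.AxisymmetricTypeIBounded
import HarnessLib

/-!
# Strategist census companions (family `s`, gen 25) for the crux `AxisymmetricKatoGlobal`

Typed, kernel-checked objects referenced by `STRATEGY-CENSUS-s20.md` (seat
`cstrat-stmt-NavierStokesRegularity-15453-s20-g25`). Nothing here is a route item; the crux is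
fixed. Sections follow the census inventory order:

1. SUMMIT-DOWN — the weakest intermediate `closes` tolerates (`NoAxisymMinimalBlowup`) and the
   re-glue through it (`closes_of_noAxisymMinimalBlowup`); the continuity-method reading of the
   crux, PROVED equivalent: `crux_iff_axisymRayClosed` (closedness of the good set along rays
   through axisymmetric data ⇔ the crux; openness is GIP 2003, barrier
   `Literature.Barriers.NavierStokesRegularity.ContinuityMethodClosedness`).
2. DECOMPOSITION A′ — `LocalBoundedSwirlRegularity` (the classical bounded-swirl problem in LOCAL
   form, open since 1968) ∧ `AxisLocalisation` (provable from landed material + a local maximum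
   principle for `Γ`) ⟹ crux, assembly `crux_of_localBoundedSwirl` proved (pure logic).
-/

noncomputable section

namespace Summit.NavierStokesRegularity.NavierStokesRegularity.Cruxes.AxisymmetricKatoGlobal.StrategistS20g25

open MeasureTheory Set Function Metric
open Literature.Analysis.FluidPDE Literature.Analysis.FunctionSpaces
open Literature.Barriers.NavierStokesRegularity
open Summit.NavierStokesRegularity.NavierStokesRegularity.Theses.AxisymmetricExtremality

/-- The route's written-out axisymmetry clause (equivariance under every rotation about the
`x₂`-axis); definitionally `IsAxisymmetric u₀`. -/
def AxClause (u₀ : EuclideanSpace ℝ (Fin 3) → EuclideanSpace ℝ (Fin 3)) : Prop :=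
  ∀ (θ : ℝ) (x : EuclideanSpace ℝ (Fin 3)),
    u₀ (WithLp.toLp 2 ![Real.cos θ * x 0 - Real.sin θ * x 1, Real.sin θ * x 0 + Real.cos θ * x 1, x 2]) =
      WithLp.toLp 2 ![Real.cos θ * u₀ x 0 - Real.sin θ * u₀ x 1,
        Real.sin θ * u₀ x 0 + Real.cos θ * u₀ x 1, u₀ x 2]

theorem axClause_iff_isAxisymmetric (u₀ : EuclideanSpace ℝ (Fin 3) → EuclideanSpace ℝ (Fin 3)) :
    AxClause u₀ ↔ IsAxisymmetric u₀ := Iff.rfl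

/-- Scalar multiples of axisymmetric fields are axisymmetric (the clause is linear in `u₀`). -/
theorem axClause_smul {u₀ : EuclideanSpace ℝ (Fin 3) → EuclideanSpace ℝ (Fin 3)} (hax : AxClause u₀)
    (s : ℝ) : AxClause (s • u₀) := by
  intro θ x
  simp only [Pi.smul_apply]
  rw [hax θ x]
  ext i
  fin_cases i <;> simp <;> ring

/-! ## 1. Summit-down -/

/-- **W0 — the weakest intermediate the deciding theorem tolerates**: for every `ν > 0` there is no
Rusin–Šverák minimal blow-up datum that is axisymmetric. `closes` consumes the crux only here. -/
def NoAxisymMinimalBlowup : Prop :=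
  ∀ ν : ℝ, 0 < ν → ¬ ∃ (u₀ : EuclideanSpace ℝ (Fin 3) → EuclideanSpace ℝ (Fin 3))
      (g : HomSobolev (EuclideanSpace ℝ (Fin 3)) (EuclideanSpace ℂ (Fin 3)) (1 / 2 : ℝ)),
    IsMinimalBlowupDatum ν u₀ g ∧ AxClause u₀

/-- crux ⇒ W0 (trivial). -/
theorem noAxisymMinimalBlowup_of_crux (h : AxisymmetricKatoGlobal) : NoAxisymMinimalBlowup := by
  rintro ν hν ⟨u₀, g, hmin, hax⟩
  obtain ⟨hL3, hrep, hdiv, -, hnot⟩ := hmin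
  exact hnot (h ν hν u₀ g hL3 hrep hdiv hax)

/-- The re-glue through W0: the same three-line contradiction as the route's `closes`. -/
theorem closes_of_noAxisymMinimalBlowup (h₂ : MinimalDatumPFold) (h₄ : PFoldToAxisymmetric)
    (hW : NoAxisymMinimalBlowup) : NavierStokesRegularity := by
  show Literature.NS.NavierStokesExistenceSmoothR3
  intro ν hν u₀ hsm hdiv hdec
  by_contra hno
  exact hW ν hν (h₄ ν hν (h₂ ν hν ⟨u₀, hsm, hdiv, hdec, hno⟩))

/-- **Continuity-method form of the crux**: for every axisymmetric datum of the crux's class, the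
set of ray parameters `{s : ℝ | s • u₀ has a global Kato solution}` is closed. -/
def AxisymRayClosed : Prop :=
  ∀ ν : ℝ, 0 < ν → ∀ (u₀ : EuclideanSpace ℝ (Fin 3) → EuclideanSpace ℝ (Fin 3))
      (g : HomSobolev (EuclideanSpace ℝ (Fin 3)) (EuclideanSpace ℂ (Fin 3)) (1 / 2 : ℝ)),
    MemLp u₀ 3 volume → g.Represents (Literature.Analysis.FunctionSpaces.EuclideanSpace.complexify ∘ u₀) →
    IsWeaklyDivFree u₀ → AxClause u₀ → IsClosed {s : ℝ | HasGlobalKatoSolution ν (s • u₀)}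

/-- crux ⇒ ray-closedness: under the crux every ray section through an axisymmetric datum is all
of `ℝ` (rays stay in the class: `MemLp.const_smul`, `represents_complexify_smul`,
`IsWeaklyDivFree.const_smul`, `axClause_smul`). -/
theorem axisymRayClosed_of_crux (h : AxisymmetricKatoGlobal) : AxisymRayClosed := by
  intro ν hν u₀ g hL3 hrep hdiv hax
  have huniv : {s : ℝ | HasGlobalKatoSolution ν (s • u₀)} = univ := by
    ext s
    simp only [mem_setOf_eq, mem_univ, iff_true]
    exact h ν hν (s • u₀) (((s : ℝ) : ℂ) • g) (hL3.const_smul s) (represents_complexify_smul hrep s)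
      (hdiv.const_smul s) (axClause_smul hax s)
  rw [huniv]
  exact isClosed_univ

/-- ray-closedness ⇒ crux: the barrier theorem `hasGlobalKatoSolution_of_isClosed_ray`
(GIP 2003 openness + Kato small data + connectedness of `ℝ`). -/
theorem crux_of_axisymRayClosed (h : AxisymRayClosed) : AxisymmetricKatoGlobal := by
  intro ν hν u₀ g hL3 hrep hdiv hax
  exact hasGlobalKatoSolution_of_isClosed_ray hν hL3 hdiv (h ν hν u₀ g hL3 hrep hdiv hax)

/-- **The crux IS the closedness step of the continuity method on axisymmetric data** (PROVED):
no a priori / closedness statement along data paths can be cheaper than the crux itself. -/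
theorem crux_iff_axisymRayClosed : AxisymmetricKatoGlobal ↔ AxisymRayClosed :=
  ⟨axisymRayClosed_of_crux, crux_of_axisymRayClosed⟩

/-! ## 2. Decomposition A′: local bounded-swirl regularity ∧ axis localisation -/

/-- **Piece LBSR (open — Ladyzhenskaya's 1968 problem, LOCAL form).** For an axisymmetric Kato
solution on `[0,T)`, smooth inside, and an axis point `x₀`: if the swirl `Γ = x₀u₁ − x₁u₀` is
BOUNDED on some parabolic cylinder `(T−δ², T) × B(x₀, δ)`, then `u` is bounded near `(T, x₀)`.
Every printed tool is a criterion strictly stronger than boundedness (Hölder `Γ`: CSTY 2008/09,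
KNSS 2009; `|Γ| ≲ |ln r|⁻²`: Lei–Zhang 2017; `|ln r|^{-3/2}`: Wei 2016; local `ln⁻³`: Seregin 2022;
one-sided Type I: Zhang 2026). -/
def LocalBoundedSwirlRegularity : Prop :=
  ∀ ν : ℝ, 0 < ν → ∀ T : ℝ, 0 < T → ∀ (u₀ : EuclideanSpace ℝ (Fin 3) → EuclideanSpace ℝ (Fin 3))
      (u : ℝ → EuclideanSpace ℝ (Fin 3) → EuclideanSpace ℝ (Fin 3)),
    MemLp u₀ 3 volume → IsWeaklyDivFree u₀ → IsAxisymmetric u₀ → IsKatoSolutionOn T ν u₀ u →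
    ContDiffOn ℝ (⊤ : ℕ∞) (uncurry u) (Ioo 0 T ×ˢ univ) → (∀ t ∈ Ioo 0 T, IsAxisymmetric (u t)) →
    ∀ x₀ : EuclideanSpace ℝ (Fin 3), cylRadius x₀ = 0 →
    (∃ δ : ℝ, 0 < δ ∧ ∃ M : ℝ, ∀ t ∈ Ioo (T - δ ^ 2) T, ∀ x ∈ ball x₀ δ, |swirl (u t) x| ≤ M) →
    IsBoundedNearTop u T x₀

/-- **Piece AL (provable — axis localisation with bounded swirl).** If an axisymmetric datum of the
class has no global Kato solution, then its maximal Kato solution has an AXIS point `(T, x₀)` near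
which it is unbounded while the swirl is bounded on a parabolic cylinder around it. Proof plan
(tree): singular point of the maximal Kato solution (`stub_katoAxisymSingularPoint`, landed);
off-axis points are bounded near the top (`stub_offAxisBounded_of_localEnergy` with
`stub_katoLocalEnergyNearTop`, landed) so `x₀` is on the axis; far-field bound
`IsKatoSolutionOn.farField_bound_holds` + compactness of the lateral surface of a tall solid
cylinder `{r < δ, |z − z₀| < Z}` whose rims lie in the far field ⇒ `|u| ≤ K` on its parabolic
boundary ⇒ `|Γ| ≤ δK` there ⇒ inside by the weak maximum principle for the swirl equation
(`swirl_transport_holds`, KNSS 2009 (1.8); `Γ = 0` on the axis). -/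
def AxisLocalisation : Prop :=
  ∀ ν : ℝ, 0 < ν → ∀ u₀ : EuclideanSpace ℝ (Fin 3) → EuclideanSpace ℝ (Fin 3),
    MemLp u₀ 3 volume → IsWeaklyDivFree u₀ → IsAxisymmetric u₀ → ¬ HasGlobalKatoSolution ν u₀ →
    ∃ T : ℝ, 0 < T ∧ ∃ (x₀ : EuclideanSpace ℝ (Fin 3))
      (u : ℝ → EuclideanSpace ℝ (Fin 3) → EuclideanSpace ℝ (Fin 3)),
      IsKatoSolutionOn T ν u₀ u ∧ ContDiffOn ℝ (⊤ : ℕ∞) (uncurry u) (Ioo 0 T ×ˢ univ) ∧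
      (∀ t ∈ Ioo 0 T, IsAxisymmetric (u t)) ∧ cylRadius x₀ = 0 ∧
      (∃ δ : ℝ, 0 < δ ∧ ∃ M : ℝ, ∀ t ∈ Ioo (T - δ ^ 2) T, ∀ x ∈ ball x₀ δ, |swirl (u t) x| ≤ M) ∧
      ¬ IsBoundedNearTop u T x₀

/-- **Assembly of A′ (PROVED, pure logic): LBSR → AL → crux.** -/
theorem crux_of_localBoundedSwirl (hL : LocalBoundedSwirlRegularity) (hA : AxisLocalisation) :
    AxisymmetricKatoGlobal := by
  intro ν hν u₀ g hL3 hrep hdiv hax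
  have hax' : IsAxisymmetric u₀ := fun θ x => hax θ x
  by_contra hng
  obtain ⟨T, hT, x₀, u, hK, hsm, haxi, hx₀, hsw, hnb⟩ := hA ν hν u₀ hL3 hdiv hax' hng
  exact hnb (hL ν hν T hT u₀ u hL3 hdiv hax' hK hsm haxi x₀ hx₀ hsw)

/-- The bounded-swirl DATA class (classical setting `Γ₀ ∈ L^∞`, Chae–Lee / KNSS): the sub-case of
the crux with bounded initial swirl. Recorded for the census remark that the crux as typed is NOT
this class (an `L³` datum may have `r u_θ` unbounded as `r → ∞`), whereas A′ shows the crux follows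
from the LOCAL bounded-swirl problem anyway. -/
def AxisymmetricKatoGlobalBddSwirl : Prop :=
  ∀ ν : ℝ, 0 < ν → ∀ (u₀ : EuclideanSpace ℝ (Fin 3) → EuclideanSpace ℝ (Fin 3))
      (g : HomSobolev (EuclideanSpace ℝ (Fin 3)) (EuclideanSpace ℂ (Fin 3)) (1 / 2 : ℝ)),
    MemLp u₀ 3 volume → g.Represents (Literature.Analysis.FunctionSpaces.EuclideanSpace.complexify ∘ u₀) →
    IsWeaklyDivFree u₀ → AxClause u₀ → (∃ M : ℝ, ∀ x, |swirl u₀ x| ≤ M) → HasGlobalKatoSolution ν u₀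

/-- crux ⇒ bounded-swirl sub-case (trivial direction; the converse is piece-2-type work, see A′). -/
theorem bddSwirl_of_crux (h : AxisymmetricKatoGlobal) : AxisymmetricKatoGlobalBddSwirl :=
  fun ν hν u₀ g h1 h2 h3 h4 _ => h ν hν u₀ g h1 h2 h3 h4

end Summit.NavierStokesRegularity.NavierStokesRegularity.Cruxes.AxisymmetricKatoGlobal.StrategistS20g25

end
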